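import Mathlib
import Literature.Computability.Complexity.CircuitDAG
import Summits.PneNP.PneNP.Theorems.SymmetryBudgetHamCompilesRankGadget

/-!
# The rank gadget is `Bud(m,g)`-symmetric and of cubic size
# (stub `stub_symmetricA`, line `kotzig-cutspan`, crux `SymmetryBudget.HamCompiles`,
# stmt-PneNP-10637)

Continuation of `SymmetryBudgetHamCompilesRankGadget.lean`. Every `ρ ∈ Bud m (gOf m)` acts on the
gate labels `RΛ m` by relabelling all vertex indices (`rmap`, the bijection `rθ ρ`); this
preserves gate functions (`rfn_rθ`, using that `ρ` preserves anchoredness) and carries argument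
lists to permutations of the relabelled lists (`rargs_rθ`; for copies of the gadget embedded in a
bigger gate type, `map_rargs_rθ`) — exactly the clauses `fn_eq`, `args_perm` of
`GateDAG.IsAut` (`CircuitDAG.lean`). Size: `Fintype.card (RΛ m) ≤ 11 (m + 1)^3` (`card_RΛ_le`).
-/

-- `Summit.PneNP.PneNP.…` duplicates `PneNP` BY DESIGN (single-problem summit, D-0017).
set_option linter.dupNamespace false

noncomputable section

namespace Summit.PneNP.PneNP.Theorems.HamCompilesKC

open Literature.Computability.Complexity
open Finset

namespace SymA

variable {m : ℕ}

/-! ### Symmetry: the budget acts on gate labels -/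

/-- Relabelling every vertex index of a gate label. -/
def rmap (f : Fin m → Fin m) : RΛ m → RΛ m
  | .one => .one
  | .free u => .free (f u)
  | .ane u a => .ane (f u) (f a)
  | .e u a => .e (f u) (f a)
  | .adj u a => .adj (f u) (f a)
  | .nadj u a => .nadj (f u) (f a)
  | .both u u' a => .both (f u) (f u') (f a)
  | .neither u u' a => .neither (f u) (f u') (f a)
  | .xnor u u' a => .xnor (f u) (f u') (f a)
  | .hieq u u' a => .hieq (f u) (f u') (f a)
  | .wit u' u a => .wit (f u') (f u) (f a)
  | .lt u' u => .lt (f u') (f u)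
  | .r k u => .r k (f u)
  | .step k u' u => .step k (f u') (f u)
  | .nr i u => .nr i (f u)
  | .eqrank i u => .eqrank i (f u)

/-- `rmap` is functorial. -/
theorem rmap_rmap (f f' : Fin m → Fin m) (l : RΛ m) :
    rmap f (rmap f' l) = rmap (f ∘ f') l := by
  cases l <;> rfl

/-- `rmap` of the identity. -/
theorem rmap_id (l : RΛ m) : rmap id l = l := by
  cases l <;> rfl

/-- The bijection of gate labels induced by a vertex permutation. -/
def rθ (ρ : Equiv.Perm (Fin m)) : RΛ m ≃ RΛ m where
  toFun := rmap ρ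
  invFun := rmap ρ.symm
  left_inv l := by rw [rmap_rmap, ρ.symm_comp_self, rmap_id]
  right_inv l := by rw [rmap_rmap, ρ.self_comp_symm, rmap_id]

/-- `rθ ρ` acts by `rmap ρ`. -/
@[simp] theorem rθ_apply (ρ : Equiv.Perm (Fin m)) (l : RΛ m) : rθ ρ l = rmap ρ l := rfl

/-- **Gate functions are preserved** by the action of a budget permutation. -/
theorem rfn_rθ {ρ : Equiv.Perm (Fin m)} (hρ : ρ ∈ Bud m (gOf m)) (l : RΛ m) :
    rfn (rθ ρ l) = rfn l := by
  cases l with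
  | free u => simp [rmap, rfn, isAnch_bud_iff hρ]
  | ane u a => simp [rmap, rfn, isAnch_bud_iff hρ]
  | _ => rfl

/-- The diagonal input map of a vertex permutation. -/
abbrev diag (ρ : Equiv.Perm (Fin m)) : Fin m × Fin m → Fin m × Fin m :=
  fun q => (ρ q.1, ρ q.2)

/-- Lists of equal functions on `Fin n` are permutations of each other (helper). -/
theorem perm_ofFn_of_eq {α : Type*} {n : ℕ} {f g : Fin n → α} (h : ∀ j, f j = g j) :
    (List.ofFn f).Perm (List.ofFn g) :=
  .of_eq (congrArg List.ofFn (funext h))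

/-- **Argument lists are permuted and relabelled** by the action of a budget permutation `ρ`
(relabelling inputs by `ρ × ρ` and gates by `rθ ρ`): fixed-arity gates literally, gates indexed
by all vertices (`hieq`, `lt`, `r`) up to the permutation `ρ` of the index (the DAG form of
Anderson–Dawar's automorphism condition, `GateDAG.IsAut.args_perm`). -/
theorem rargs_rθ {ρ : Equiv.Perm (Fin m)} (hρ : ρ ∈ Bud m (gOf m)) (l : RΛ m) :
    (List.ofFn (rargs (rθ ρ l))).Perm
      ((List.ofFn (rargs l)).map (Sum.map (diag ρ) (rθ ρ))) := by
  rw [List.map_ofFn]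
  cases l with
  | one => exact perm_ofFn_of_eq fun j => j.elim0
  | free u => exact perm_ofFn_of_eq fun j => j.elim0
  | ane u a => exact perm_ofFn_of_eq fun j => j.elim0
  | e u a => exact perm_ofFn_of_eq fun j => by fin_cases j <;> rfl
  | adj u a => exact perm_ofFn_of_eq fun j => by fin_cases j <;> rfl
  | nadj u a => exact perm_ofFn_of_eq fun j => by fin_cases j; rfl
  | both u u' a => exact perm_ofFn_of_eq fun j => by fin_cases j <;> rfl
  | neither u u' a => exact perm_ofFn_of_eq fun j => by fin_cases j <;> rfl
  | xnor u u' a => exact perm_ofFn_of_eq fun j => by fin_cases j <;> rfl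
  | hieq u u' a =>
    let G : Fin m → RWire m := fun j =>
      Sum.inr (if IsAnch m (ρ a) ∧ ρ a < j then .xnor (ρ u) (ρ u') j else .one)
    have h1 : List.ofFn (rargs (rθ ρ (.hieq u u' a))) = List.ofFn G := rfl
    have h2 : List.ofFn (Sum.map (diag ρ) (rθ ρ) ∘ rargs (.hieq u u' a)) =
        List.ofFn (G ∘ ρ) := by
      refine congrArg List.ofFn (funext fun j => ?_)
      show Sum.inr (rmap ρ (if IsAnch m a ∧ a < j then .xnor u u' j else .one)) =
        Sum.inr (if IsAnch m (ρ a) ∧ ρ a < ρ j then .xnor (ρ u) (ρ u') (ρ j) else .one)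
      by_cases hc : IsAnch m a ∧ a < j
      · rw [if_pos hc, if_pos ((guard_bud_iff hρ a j).2 hc)]; rfl
      · rw [if_neg hc, if_neg (mt (guard_bud_iff hρ a j).1 hc)]; rfl
    rw [h1, h2]
    exact (Equiv.Perm.ofFn_comp_perm ρ G).symm
  | wit u' u a => exact perm_ofFn_of_eq fun j => by fin_cases j <;> rfl
  | lt u' u =>
    let G : Fin m → RWire m := fun a => Sum.inr (.wit (ρ u') (ρ u) a)
    have h1 : List.ofFn (rargs (rθ ρ (.lt u' u))) = List.ofFn G := rfl
    have h2 : List.ofFn (Sum.map (diag ρ) (rθ ρ) ∘ rargs (.lt u' u)) = List.ofFn (G ∘ ρ) :=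
      rfl
    rw [h1, h2]
    exact (Equiv.Perm.ofFn_comp_perm ρ G).symm
  | r k u =>
    rcases k with ⟨_ | k, hk⟩
    · exact perm_ofFn_of_eq fun j => rfl
    · let G : Fin m → RWire m := fun j =>
        Sum.inr (.step ⟨k, Nat.lt_of_succ_lt_succ hk⟩ j (ρ u))
      have h1 : List.ofFn (rargs (rθ ρ (.r ⟨k + 1, hk⟩ u))) = List.ofFn G := rfl
      have h2 : List.ofFn (Sum.map (diag ρ) (rθ ρ) ∘ rargs (.r ⟨k + 1, hk⟩ u)) =
          List.ofFn (G ∘ ρ) := rfl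
      rw [h1, h2]
      exact (Equiv.Perm.ofFn_comp_perm ρ G).symm
  | step k u' u => exact perm_ofFn_of_eq fun j => by fin_cases j <;> rfl
  | nr i u => exact perm_ofFn_of_eq fun j => by fin_cases j; rfl
  | eqrank i u => exact perm_ofFn_of_eq fun j => by fin_cases j <;> rfl

/-- **Embedded copies.** For a copy of the gadget inside a bigger gate type `Λ'` (embedding `emb`,
a bijection `θ'` of `Λ'` extending `rθ ρ` along `emb`), the embedded argument lists are permuted
and relabelled by `ρ × ρ` and `θ'` — the `args_perm` clause of `GateDAG.IsAut` for the gadget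
gates of the bigger DAG. -/
theorem map_rargs_rθ {Λ' : Type*} {ρ : Equiv.Perm (Fin m)} (hρ : ρ ∈ Bud m (gOf m))
    (emb : RΛ m → Λ') (θ' : Λ' → Λ') (hθ' : ∀ l, θ' (emb l) = emb (rθ ρ l))
    (l : RΛ m) :
    (List.ofFn fun a => (rargs (rθ ρ l) a).map id emb).Perm
      ((List.ofFn fun a => (rargs l a).map id emb).map (Sum.map (diag ρ) θ')) := by
  have hcomm : Sum.map (diag ρ) θ' ∘ Sum.map id emb =
      (Sum.map id emb ∘ Sum.map (diag ρ) (rθ ρ) : RWire m → (Fin m × Fin m) ⊕ Λ') := by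
    funext w
    cases w with
    | inl q => rfl
    | inr l' => exact congrArg Sum.inr (hθ' l')
  have e1 : (List.ofFn fun a => (rargs (rθ ρ l) a).map id emb) =
      (List.ofFn (rargs (rθ ρ l))).map (Sum.map id emb) := by rw [List.map_ofFn]; rfl
  have e2 : (List.ofFn fun a => (rargs l a).map id emb) =
      (List.ofFn (rargs l)).map (Sum.map id emb) := by rw [List.map_ofFn]; rfl
  rw [e1, e2, List.map_map, hcomm, ← List.map_map]
  exact (rargs_rθ hρ l).map _

/-! ### Size -/

/-- The number of gadget gates. -/
theorem card_RΛ (m : ℕ) : Fintype.card (RΛ m) =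
    1 + m + 5 * (m * m) + 5 * (m * m * m) + (gOf m + 1) * m + gOf m * (m * m) +
      2 * (gOf m * m) := by
  rw [← Fintype.card_congr (RΛ.proxyTypeEquiv m)]
  simp [Fintype.card_sum]
  ring

/-- **Size bound**: at most `11 (m + 1)^3` gadget gates. -/
theorem card_RΛ_le (m : ℕ) : Fintype.card (RΛ m) ≤ 11 * (m + 1) ^ 3 := by
  rw [card_RΛ]
  have hg := gOf_le m
  calc 1 + m + 5 * (m * m) + 5 * (m * m * m) + (gOf m + 1) * m + gOf m * (m * m) + 2 * (gOf m * m)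
      ≤ 1 + m + 5 * (m * m) + 5 * (m * m * m) + (m + 1) * m + m * (m * m) + 2 * (m * m) := by
        gcongr
    _ ≤ 1 + m + 5 * (m * m) + 5 * (m * m * m) + (m + 1) * m + m * (m * m) + 2 * (m * m) +
        (5 * (m * m * m) + 25 * (m * m) + 31 * m + 10) := Nat.le_add_right _ _
    _ = 11 * (m + 1) ^ 3 := by ring

/-- The number of gadget gates is at most `11 (m+1)^3` (ASCII-named restatement of `card_RΛ_le`,
the registered sub-goal of this file). -/
theorem card_rankGadget_le (m : ℕ) : Fintype.card (RΛ m) ≤ 11 * (m + 1) ^ 3 := card_RΛ_le m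

end SymA

end Summit.PneNP.PneNP.Theorems.HamCompilesKC
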